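import Literature.NumberTheory.Sieve.GoldstonYildirimLemma21Proofs
import Literature.NumberTheory.Sieve.GreenTao2008SharpGYMoebius
import HarnessLib

/-!
# Goldston–Yıldırım I, Lemma 2.1, (2.11)–(2.12) at `j = 1`: proof

Discharge (`goldstonYildirim_lemma21_log_j1_holds`) of the named fact
`Literature.NumberTheory.Sieve.goldstonYildirim_lemma21_log_j1` of
`Literature/NumberTheory/Sieve/GoldstonYildirimLemma21.lean`:
D. A. Goldston, C. Y. Yıldırım, *Higher correlations of divisor sums related to primes I: triple
correlations*, Integers 3 (2003) A5 = arXiv:math/0111212, Lemma 2.1 (p. 13), eq. (2.11)–(2.12)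
in the case `j = 1`: there is an absolute `c > 0` such that for every `B > 0` there is `C = C(B)`
with

  `|∑_{d ≤ R, (d,k)=1} μ(d)/φ(d) · log(R/d) - 𝔖({0,k})| ≤ C exp(-c √log R)`

for all `k ≥ 1`, `R ≥ 1`, `k ≤ R^B` (`𝔖({0,k}) = 𝔖₂(k)`, the pair singular series (2.9)).

## The proof (GY §3, pp. 15–17, with the contour integral replaced by a real-variable input)

Goldston–Yıldırım write the Dirichlet series of `μ(n) 𝟙_{(n,k)=1}/φ(n)` as (3.1)
`F(s) = ζ(s+1)⁻¹ g_k(s) h_k(s)`, `g_k(s) = ∏_{p ∣ k} (1 - p^{-s-1})⁻¹`,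
`h_k(s) = ∏_{p ∤ k} (1 - 1/((p-1)(p^{s+1} - 1)))` (case `j = 1`), shift the contour in
`(2πi)⁻¹ ∫ F(s) R^s ds/s²` into the zero-free region of `ζ(s+1)`, pick up the residue
`g_k(0) h_k(0) = 𝔖₂(k)` at `s = 0` (p. 16) and bound `|g_k(s)| ≪ e^{4√log k}` for `σ ≥ -1/4`
((3.5)). We follow exactly this factorisation but read it on the coefficient side, where the
factor `ζ(s+1)⁻¹ R^s/s²` is the tree's PROVED real-variable input

  `M₁(u) = ∑_{e ≤ u} μ(e) log(u/e)/e = 1 + O(e^{-c₁√log u})`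

(`Literature.NumberTheory.Sieve.GreenTao2008.exists_abs_moebiusLogSum_sub_one_le`, de la
Vallée-Poussin–Landau, from `∑ μ(n)/n ≪ e^{-c√log x}` and `∫_1^∞ m(t) dt/t = 1`); this is the
"genuinely shorter road" allowed by the tree and avoids Perron's formula:

* `hfun k` is the multiplicative function `h_k` with `h_k(p^j) = p^{-j}` (`p ∣ k`) and
  `h_k(p^j) = -1/(p^j (p-1))` (`p ∤ k`, `j ≥ 1`), i.e. the coefficients of `g_k(s) h_k(s)`, and
  `muDiv_mul_hfun : μ/id ⋆ h_k = μ 𝟙_{(·,k)=1}/φ` is (3.1) (checked on prime powers);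
* `sum_gfun_mul_log_eq`: `∑_{d ≤ R,(d,k)=1} μ(d)/φ(d) log(R/d) = ∑_{m ≤ R} h_k(m) M₁(R/m)`
  (Dirichlet's rearrangement), the analogue of (3.2);
* `singularSeries_zero_pair_eq_tsum`: `∑_m h_k(m) = ∏_p ∑_e h_k(p^e) = 𝔖({0,k})` (Mathlib's
  Euler product for summable multiplicative functions; the local factors are `(1 - 1/p)⁻¹` at
  `p ∣ k` and `1 - 1/(p-1)²` at `p ∤ k`, which are the Euler factors `(1 - ν_p/p)(1 - 1/p)⁻²` of
  `Literature.NumberTheory.Sieve.singularSeries {0, k}` since `ν_{{0,k}}(p) = 1` resp. `2`) — the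
  residue computation of p. 16;
* `sum_absSqrt_hfun_le`: `∑_{m ≤ N} |h_k(m)| √m ≤ e¹⁶ ∏_{p ∣ k} (1 - p^{-1/2})⁻¹ ≤ e¹⁶ e^{12√ω(k)}`
  (`Gk_le`; `ω(k) ≤ log₂ k`) — the bound (3.5) `|g_k(s)| ≪ e^{4√log k}` on `σ = -1/2`, and
  `sum_abs_hfun_le`: `∑_{m ≤ N} |h_k(m)| ≤ e⁸ k/φ(k) ≤ e⁸ (ω(k) + 1)`;
* assembly: `∑_{m ≤ R} h_k(m) M₁(R/m) - 𝔖 = ∑_{m ≤ R} h_k(m)(M₁(R/m) - 1) - ∑_{m > R} h_k(m)`; the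
  terms `m ≤ √R` give `≪ (ω(k)+1) e^{-(c₁/2)√log R}`, the terms `m > √R` and the tail give
  `≪ R^{-1/4} e^{12√ω(k)}`; with `ω(k) ≤ B log R / log 2` both are `≤ C(B) e^{-(c₁/4)√log R}`.
  Hence `c = c₁/4` is absolute and only `C` depends on `B`, as in the vendored statement (GY:
  "`c₁` is an absolute positive constant", the implied constant depending on that in
  `log |k| ≪ log R`).

All constants are explicit and crude. Everything in this file is proved (no new facts).

## References

* D. A. Goldston, C. Y. Yıldırım, *Higher correlations of divisor sums related to primes I:
  triple correlations*, Integers 3 (2003), A5; arXiv:math/0111212, Lemma 2.1 and §3.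
  [cite: GoldstonYildirim2001, Lemma 2.1 (2.11) with j = 1]
* H. L. Montgomery, R. C. Vaughan, *Multiplicative Number Theory I*, CUP 2007, §6.2, §8.1
  (`∑ μ(n)/n`, `∑ μ(n) log n/n`). [cite: MontgomeryVaughan2007, §8.1]
-/

noncomputable section

open Finset Real ArithmeticFunction Filter Topology

open scoped ArithmeticFunction.Moebius

namespace Literature.NumberTheory.Sieve

namespace GoldstonYildirimLemma21

variable (k : ℕ)

/-! ### The multiplicative function `h_k` (coefficients of `g_k(s) h_k(s)` in GY (3.1)) -/

/-- Local data of `h_k`: `h_k(p⁰) = 1`; for `j ≥ 1`, `h_k(p^j) = p^{-j}` if `p ∣ k` and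
`h_k(p^j) = -1/(p^j (p - 1))` if `p ∤ k`. [cite: GoldstonYildirim2001, (3.1)] -/
def hloc (p j : ℕ) : ℝ :=
  if j = 0 then 1 else if p ∣ k then ((p : ℝ) ^ j)⁻¹ else -((p : ℝ) ^ j * ((p : ℝ) - 1))⁻¹

/-- `h_k`, the multiplicative function with Dirichlet series
`∏_{p ∣ k} (1 - p^{-1-s})⁻¹ ∏_{p ∤ k} (1 - 1/((p-1)(p^{s+1} - 1))) = g_k(s) h_k(s)` of
Goldston–Yıldırım (3.1) (case `j = 1`), so that `μ(n) 𝟙_{(n,k)=1}/φ(n) = (h_k ⋆ μ/id)(n)`.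
[cite: GoldstonYildirim2001, (3.1)] -/
def hfun : ArithmeticFunction ℝ :=
  ⟨fun n => if n = 0 then 0 else n.factorization.prod (hloc k), by simp⟩

/-- `h_k(p⁰) = 1`. [folklore] -/
theorem hloc_zero (p : ℕ) : hloc k p 0 = 1 := by simp [hloc]

/-- `h_k(p^j) = p^{-j}` for `p ∣ k` (all `j`). [folklore] -/
theorem hloc_of_dvd {p : ℕ} (hpk : p ∣ k) (j : ℕ) : hloc k p j = ((p : ℝ)⁻¹) ^ j := by
  unfold hloc
  split_ifs with hj
  · simp [hj]
  · rw [inv_pow]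

/-- `h_k(p^j) = -1/(p^j (p-1))` for `p ∤ k`, `j ≥ 1`. [folklore] -/
theorem hloc_of_not_dvd {p : ℕ} (hpk : ¬p ∣ k) {j : ℕ} (hj : j ≠ 0) :
    hloc k p j = -((p : ℝ) ^ j * ((p : ℝ) - 1))⁻¹ := by
  unfold hloc
  rw [if_neg hj, if_neg hpk]

/-- Unfolding `h_k` at `n ≠ 0`. [folklore] -/
theorem hfun_apply {n : ℕ} (hn : n ≠ 0) : hfun k n = n.factorization.prod (hloc k) := by
  show (if n = 0 then (0 : ℝ) else n.factorization.prod (hloc k)) = _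
  rw [if_neg hn]

/-- `h_k` is multiplicative. [folklore] -/
theorem isMultiplicative_hfun : (hfun k).IsMultiplicative := by
  refine IsMultiplicative.iff_ne_zero.2 ⟨?_, ?_⟩
  · rw [hfun_apply k one_ne_zero]; simp
  · intro m n hm hn hmn
    rw [hfun_apply k (Nat.mul_ne_zero hm hn), hfun_apply k hm, hfun_apply k hn,
      Nat.factorization_mul_of_coprime hmn, Finsupp.prod_add_index_of_disjoint]
    rw [Nat.support_factorization, Nat.support_factorization]
    exact hmn.disjoint_primeFactors

/-- `h_k` at prime powers. [folklore] -/
theorem hfun_apply_prime_pow {p : ℕ} (hp : p.Prime) (j : ℕ) : hfun k (p ^ j) = hloc k p j := by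
  rcases Nat.eq_zero_or_pos j with rfl | hj
  · rw [pow_zero, (isMultiplicative_hfun k).map_one, hloc_zero]
  · rw [hfun_apply k (pow_ne_zero _ hp.ne_zero), Nat.Prime.factorization_pow hp,
      Finsupp.prod_single_index (hloc_zero k p)]

/-! ### `μ/id` and `μ 𝟙_{(·,k)=1}/φ` -/

/-- `a(n) = μ(n)/n`. [folklore] -/
def muDiv : ArithmeticFunction ℝ := ⟨fun n => (μ n : ℝ) / n, by simp⟩

/-- Unfolding `a`. [folklore] -/
theorem muDiv_apply (n : ℕ) : muDiv n = (μ n : ℝ) / n := rfl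

/-- `a = μ/id` is multiplicative. [folklore] -/
theorem isMultiplicative_muDiv : muDiv.IsMultiplicative := by
  refine ⟨by simp [muDiv_apply], ?_⟩
  intro m n hmn
  rw [muDiv_apply, muDiv_apply, muDiv_apply,
    ArithmeticFunction.isMultiplicative_moebius.map_mul_of_coprime hmn]
  push_cast
  rw [div_mul_div_comm]

/-- `a` at prime powers: `a(p) = -1/p`, `a(p^j) = 0` for `j ≥ 2`. [folklore] -/
theorem muDiv_apply_prime_pow {p : ℕ} (hp : p.Prime) {j : ℕ} (hj : j ≠ 0) :
    muDiv (p ^ j) = if j = 1 then -1 / (p : ℝ) else 0 := by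
  rw [muDiv_apply, ArithmeticFunction.moebius_apply_prime_pow hp hj]
  split_ifs with h
  · subst h; simp [neg_div]
  · simp

/-- `g_k(n) = μ(n)/φ(n)` if `(n, k) = 1` and `0` otherwise (the summand of Lemma 2.1 at `j = 1`).
[cite: GoldstonYildirim2001, Lemma 2.1] -/
def gfun : ArithmeticFunction ℝ :=
  ⟨fun n => if n.Coprime k then (μ n : ℝ) / (n.totient : ℝ) else 0, by simp⟩

/-- Unfolding `g_k`. [folklore] -/
theorem gfun_apply (n : ℕ) :
    gfun k n = if n.Coprime k then (μ n : ℝ) / (n.totient : ℝ) else 0 := rfl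

/-- `g_k` is multiplicative. [folklore] -/
theorem isMultiplicative_gfun : (gfun k).IsMultiplicative := by
  refine IsMultiplicative.iff_ne_zero.2 ⟨?_, ?_⟩
  · rw [gfun_apply, if_pos (Nat.coprime_one_left k)]; simp
  · intro m n hm hn hmn
    rw [gfun_apply, gfun_apply k m, gfun_apply k n]
    by_cases hco : (m * n).Coprime k
    · obtain ⟨h1, h2⟩ := Nat.coprime_mul_iff_left.1 hco
      rw [if_pos hco, if_pos h1, if_pos h2, isMultiplicative_moebius.map_mul_of_coprime hmn,
        Nat.totient_mul hmn]
      push_cast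
      rw [div_mul_div_comm]
    · rw [if_neg hco]
      rw [Nat.coprime_mul_iff_left, not_and_or] at hco
      rcases hco with h | h
      · rw [if_neg h, zero_mul]
      · rw [if_neg h, mul_zero]

/-- `g_k` at prime powers: `g_k(p^j) = 0` if `p ∣ k`; otherwise `g_k(p) = -1/(p-1)` and
`g_k(p^j) = 0` for `j ≥ 2`. [folklore] -/
theorem gfun_apply_prime_pow {p : ℕ} (hp : p.Prime) {j : ℕ} (hj : j ≠ 0) :
    gfun k (p ^ j) = if p ∣ k then 0 else if j = 1 then -1 / ((p : ℝ) - 1) else 0 := by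
  rw [gfun_apply]
  by_cases hpk : p ∣ k
  · have : ¬(p ^ j).Coprime k := fun hc => hp.ne_one
      (Nat.Coprime.eq_one_of_dvd ((Nat.coprime_pow_left_iff (Nat.pos_of_ne_zero hj) _ _).1 hc) hpk)
    rw [if_neg this, if_pos hpk]
  · have hc : (p ^ j).Coprime k := (Nat.coprime_pow_left_iff (Nat.pos_of_ne_zero hj) _ _).2
      ((Nat.Prime.coprime_iff_not_dvd hp).2 hpk)
    rw [if_pos hc, if_neg hpk, ArithmeticFunction.moebius_apply_prime_pow hp hj]
    split_ifs with h1
    · subst h1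
      rw [pow_one, Nat.totient_prime hp, Nat.cast_sub hp.one_le]
      push_cast
      ring
    · simp

/-- **GY (3.1) in coefficient form**: `μ/id ⋆ h_k = g_k`, i.e.
`μ(n) 𝟙_{(n,k)=1}/φ(n) = ∑_{me = n} h_k(m) μ(e)/e`. [cite: GoldstonYildirim2001, (3.1)] -/
theorem muDiv_mul_hfun : muDiv * hfun k = gfun k := by
  rw [(isMultiplicative_muDiv.mul (isMultiplicative_hfun k)).eq_iff_eq_on_prime_powers _ _
    (isMultiplicative_gfun k)]
  intro p j hp
  rcases Nat.eq_zero_or_pos j with rfl | hj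
  · rw [pow_zero, (isMultiplicative_muDiv.mul (isMultiplicative_hfun k)).map_one,
      (isMultiplicative_gfun k).map_one]
  have hp0 : (p : ℝ) ≠ 0 := by exact_mod_cast hp.ne_zero
  have hp1 : (p : ℝ) - 1 ≠ 0 := by
    have : (2 : ℝ) ≤ p := by exact_mod_cast hp.two_le
    linarith
  -- only the terms `i = 0, 1` of `∑_i a(p^i) h(p^{j-i})` survive
  have key : (muDiv * hfun k) (p ^ j) = hfun k (p ^ j) - hfun k (p ^ (j - 1)) / p := by
    have e1 : muDiv p = -1 / p := by
      have := muDiv_apply_prime_pow hp one_ne_zero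
      rwa [pow_one, if_pos rfl] at this
    rw [SquarefreeSums.mul_apply_prime_pow _ _ hp]
    obtain ⟨j', rfl⟩ := Nat.exists_eq_succ_of_ne_zero hj.ne'
    rw [Finset.sum_range_succ', Finset.sum_range_succ']
    rw [Finset.sum_eq_zero (fun i _ => by
      rw [muDiv_apply_prime_pow hp (by omega : i + 1 + 1 ≠ 0), if_neg (by omega), zero_mul]),
      zero_add, pow_zero, isMultiplicative_muDiv.map_one, one_mul, zero_add, pow_one, e1,
      Nat.succ_sub_one, Nat.sub_zero]
    ring
  rw [key, gfun_apply_prime_pow k hp hj.ne', hfun_apply_prime_pow k hp, hfun_apply_prime_pow k hp]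
  by_cases hpk : p ∣ k
  · rw [if_pos hpk, hloc_of_dvd k hpk, hloc_of_dvd k hpk]
    obtain ⟨j', rfl⟩ := Nat.exists_eq_succ_of_ne_zero hj.ne'
    rw [Nat.succ_sub_one, pow_succ]
    field_simp
    ring
  · rw [if_neg hpk, hloc_of_not_dvd k hpk hj.ne']
    by_cases hj1 : j = 1
    · subst hj1
      rw [if_pos rfl, Nat.sub_self, hloc_zero]
      field_simp
      ring
    · rw [if_neg hj1, hloc_of_not_dvd k hpk (by omega : j - 1 ≠ 0)]
      obtain ⟨j', rfl⟩ := Nat.exists_eq_succ_of_ne_zero hj.ne'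
      rw [Nat.succ_sub_one, pow_succ]
      field_simp
      ring

/-! ### The hyperbola rearrangement -/

/-- `∑_{n ≤ R} g_k(n) log(R/n) = ∑_{m ≤ R} h_k(m) M₁(R/m)` with
`M₁(u) = ∑_{e ≤ u} μ(e) log(u/e)/e` (Dirichlet's rearrangement of `g_k = h_k ⋆ μ/id`).
[cite: GoldstonYildirim2001, (3.1)–(3.2)] -/
theorem sum_gfun_mul_log_eq (R : ℝ) :
    ∑ n ∈ Icc 1 ⌊R⌋₊, gfun k n * Real.log (R / n) =
      ∑ m ∈ Icc 1 ⌊R⌋₊, hfun k m * GreenTao2008.moebiusLogSum (R / m) := by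
  have h1 : ∀ n ∈ Icc 1 ⌊R⌋₊, gfun k n * Real.log (R / n) =
      ∑ q ∈ n.divisorsAntidiagonal, hfun k q.1 * (muDiv q.2 * Real.log (R / q.1 / q.2)) := by
    intro n _
    rw [← muDiv_mul_hfun, mul_comm muDiv (hfun k), ArithmeticFunction.mul_apply, Finset.sum_mul]
    refine Finset.sum_congr rfl fun q hq => ?_
    rw [Nat.mem_divisorsAntidiagonal] at hq
    have : (n : ℝ) = q.1 * q.2 := by rw [← hq.1]; push_cast; ring
    rw [this, ← div_div, mul_assoc]
  rw [Finset.sum_congr rfl h1, SquarefreeSums.sum_Icc_sum_divisorsAntidiagonal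
    (fun d e => hfun k d * (muDiv e * Real.log (R / d / e))) ⌊R⌋₊]
  refine Finset.sum_congr rfl fun m _ => ?_
  rw [← Finset.mul_sum, GreenTao2008.moebiusLogSum_def, Nat.floor_div_natCast]
  rfl

/-- The sum of Lemma 2.1 (`j = 1`) is `∑_{n ≤ R} g_k(n) log(R/n)`. [folklore] -/
theorem sum_filter_coprime_eq (R : ℝ) :
    ∑ d ∈ (Icc 1 ⌊R⌋₊).filter (fun d => Nat.Coprime d k),
        ((μ d : ℤ) : ℝ) / (Nat.totient d : ℝ) * Real.log (R / d) =
      ∑ n ∈ Icc 1 ⌊R⌋₊, gfun k n * Real.log (R / n) := by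
  rw [Finset.sum_filter]
  refine Finset.sum_congr rfl fun d _ => ?_
  rw [gfun_apply, ite_mul, zero_mul]


/-! ### Absolute moments of `h_k` (GY (3.5)) -/

/-- `|h_k|` as an arithmetic function. [folklore] -/
def habs : ArithmeticFunction ℝ := ⟨fun n => |hfun k n|, by simp⟩

/-- Unfolding `|h_k|`. [folklore] -/
theorem habs_apply (n : ℕ) : habs k n = |hfun k n| := rfl

/-- `|h_k|` is multiplicative. [folklore] -/
theorem isMultiplicative_habs : (habs k).IsMultiplicative := by
  refine ⟨?_, ?_⟩
  · rw [habs_apply, (isMultiplicative_hfun k).map_one, abs_one]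
  · intro m n hmn
    rw [habs_apply, habs_apply, habs_apply, (isMultiplicative_hfun k).map_mul_of_coprime hmn,
      abs_mul]

/-- `|h_k(n)| √n` as an arithmetic function. [folklore] -/
def habsSqrt : ArithmeticFunction ℝ := ⟨fun n => |hfun k n| * Real.sqrt n, by simp⟩

/-- Unfolding `|h_k| √·`. [folklore] -/
theorem habsSqrt_apply (n : ℕ) : habsSqrt k n = |hfun k n| * Real.sqrt n := rfl

/-- `|h_k| √·` is multiplicative. [folklore] -/
theorem isMultiplicative_habsSqrt : (habsSqrt k).IsMultiplicative := by
  refine ⟨?_, ?_⟩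
  · rw [habsSqrt_apply, (isMultiplicative_hfun k).map_one]; simp
  · intro m n hmn
    rw [habsSqrt_apply, habsSqrt_apply, habsSqrt_apply,
      (isMultiplicative_hfun k).map_mul_of_coprime hmn, abs_mul, Nat.cast_mul,
      Real.sqrt_mul (Nat.cast_nonneg _)]
    ring

/-- `√(p^j) = (√p)^j`. [folklore] -/
theorem sqrt_natCast_pow (p j : ℕ) : Real.sqrt (((p ^ j : ℕ) : ℝ)) = Real.sqrt p ^ j := by
  push_cast
  rw [show ((p : ℝ)) ^ j = (Real.sqrt p ^ j) ^ 2 by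
    rw [← pow_mul, mul_comm, pow_mul, Real.sq_sqrt (Nat.cast_nonneg p)],
    Real.sqrt_sq (pow_nonneg (Real.sqrt_nonneg _) _)]

/-- `|h_k(p^j)| = p^{-j}` for `p ∣ k`. [folklore] -/
theorem abs_hfun_prime_pow_of_dvd {p : ℕ} (hp : p.Prime) (hpk : p ∣ k) (j : ℕ) :
    |hfun k (p ^ j)| = ((p : ℝ)⁻¹) ^ j := by
  rw [hfun_apply_prime_pow k hp, hloc_of_dvd k hpk, abs_of_nonneg (by positivity)]

/-- `|h_k(p^j)| = (p-1)⁻¹ p^{-j}` for `p ∤ k`, `j ≥ 1`. [folklore] -/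
theorem abs_hfun_prime_pow_of_not_dvd {p : ℕ} (hp : p.Prime) (hpk : ¬p ∣ k) {j : ℕ} (hj : j ≠ 0) :
    |hfun k (p ^ j)| = ((p : ℝ) - 1)⁻¹ * ((p : ℝ)⁻¹) ^ j := by
  have hp1 : 0 < (p : ℝ) - 1 := by
    have : (2 : ℝ) ≤ p := by exact_mod_cast hp.two_le
    linarith
  rw [hfun_apply_prime_pow k hp, hloc_of_not_dvd k hpk hj, abs_neg, mul_inv, inv_pow,
    abs_of_nonneg (by positivity), mul_comm]

/-- Local factor of `∑ |h_k|` at `p ∣ k`: `∑_j p^{-j} ≤ (1 - 1/p)⁻¹`. [folklore] -/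
theorem sum_abs_hfun_prime_pow_le_of_dvd {p : ℕ} (hp : p.Prime) (hpk : p ∣ k) (N : ℕ) :
    ∑ j ∈ Finset.range (N + 1), |hfun k (p ^ j)| ≤ (1 - (p : ℝ)⁻¹)⁻¹ := by
  have hp2 : (2 : ℝ) ≤ p := by exact_mod_cast hp.two_le
  have hr0 : 0 ≤ (p : ℝ)⁻¹ := by positivity
  have hr1 : (p : ℝ)⁻¹ < 1 := inv_lt_one_of_one_lt₀ (by linarith)
  simp_rw [abs_hfun_prime_pow_of_dvd k hp hpk]
  rw [Finset.range_eq_Ico]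
  refine (geom_sum_Ico_le_of_lt_one hr0 hr1).trans (le_of_eq ?_)
  rw [pow_zero, one_div]

/-- Local factor of `∑ |h_k|` at `p ∤ k`: `1 + (p-1)⁻¹ ∑_{j ≥ 1} p^{-j} ≤ 1 + 1/(p-1)²`. [folklore] -/
theorem sum_abs_hfun_prime_pow_le_of_not_dvd {p : ℕ} (hp : p.Prime) (hpk : ¬p ∣ k) (N : ℕ) :
    ∑ j ∈ Finset.range (N + 1), |hfun k (p ^ j)| ≤ 1 + 1 / ((p : ℝ) - 1) ^ 2 := by
  have hp2 : (2 : ℝ) ≤ p := by exact_mod_cast hp.two_le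
  have hp0 : (p : ℝ) ≠ 0 := by positivity
  have hp1 : 0 < (p : ℝ) - 1 := by linarith
  have hr0 : 0 ≤ (p : ℝ)⁻¹ := by positivity
  have hr1 : (p : ℝ)⁻¹ < 1 := inv_lt_one_of_one_lt₀ (by linarith)
  rw [Finset.range_eq_Ico, Finset.sum_eq_sum_Ico_succ_bot (Nat.succ_pos N), pow_zero,
    (isMultiplicative_hfun k).map_one, abs_one, zero_add]
  apply add_le_add le_rfl
  rw [Finset.sum_congr rfl fun j hj =>
    abs_hfun_prime_pow_of_not_dvd k hp hpk (by have := (Finset.mem_Ico.1 hj).1; omega),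
    ← Finset.mul_sum]
  calc ((p : ℝ) - 1)⁻¹ * ∑ j ∈ Ico 1 (N + 1), ((p : ℝ)⁻¹) ^ j
      ≤ ((p : ℝ) - 1)⁻¹ * (((p : ℝ)⁻¹) ^ 1 / (1 - (p : ℝ)⁻¹)) :=
        mul_le_mul_of_nonneg_left (geom_sum_Ico_le_of_lt_one hr0 hr1) (by positivity)
    _ = 1 / ((p : ℝ) - 1) ^ 2 := by
        field_simp

/-- Local factor of `∑ |h_k| √·` at `p ∣ k`: `∑_j p^{-j/2} ≤ (1 - p^{-1/2})⁻¹`. [folklore] -/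
theorem sum_absSqrt_hfun_prime_pow_le_of_dvd {p : ℕ} (hp : p.Prime) (hpk : p ∣ k) (N : ℕ) :
    ∑ j ∈ Finset.range (N + 1), |hfun k (p ^ j)| * Real.sqrt (((p ^ j : ℕ) : ℝ)) ≤
      (1 - (p : ℝ) ^ (-(1 / 2 : ℝ)))⁻¹ := by
  have hp2 : (2 : ℝ) ≤ p := by exact_mod_cast hp.two_le
  have hs1 : 1 < Real.sqrt p := by
    rw [show (1 : ℝ) = Real.sqrt 1 from Real.sqrt_one.symm]
    exact Real.sqrt_lt_sqrt zero_le_one (by linarith)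
  have hs0 : Real.sqrt p ≠ 0 := by positivity
  have hr0 : 0 ≤ (Real.sqrt p)⁻¹ := by positivity
  have hr1 : (Real.sqrt p)⁻¹ < 1 := inv_lt_one_of_one_lt₀ hs1
  have hterm : ∀ j, |hfun k (p ^ j)| * Real.sqrt (((p ^ j : ℕ) : ℝ)) = ((Real.sqrt p)⁻¹) ^ j := by
    intro j
    rw [abs_hfun_prime_pow_of_dvd k hp hpk, sqrt_natCast_pow, ← mul_pow]
    congr 1
    rw [show ((p : ℝ))⁻¹ = (Real.sqrt p)⁻¹ * (Real.sqrt p)⁻¹ by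
      rw [← mul_inv, Real.mul_self_sqrt (Nat.cast_nonneg p)]]
    field_simp
  simp_rw [hterm]
  rw [Finset.range_eq_Ico, Real.rpow_neg (Nat.cast_nonneg p), ← Real.sqrt_eq_rpow]
  refine (geom_sum_Ico_le_of_lt_one hr0 hr1).trans (le_of_eq ?_)
  rw [pow_zero, one_div]

/-- Local factor of `∑ |h_k| √·` at `p ∤ k`: `≤ 1 + 1/((p-1)(√p-1))`. [folklore] -/
theorem sum_absSqrt_hfun_prime_pow_le_of_not_dvd {p : ℕ} (hp : p.Prime) (hpk : ¬p ∣ k) (N : ℕ) :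
    ∑ j ∈ Finset.range (N + 1), |hfun k (p ^ j)| * Real.sqrt (((p ^ j : ℕ) : ℝ)) ≤
      1 + 1 / (((p : ℝ) - 1) * (Real.sqrt p - 1)) := by
  have hp2 : (2 : ℝ) ≤ p := by exact_mod_cast hp.two_le
  have hp1 : 0 < (p : ℝ) - 1 := by linarith
  have hs1 : 1 < Real.sqrt p := by
    rw [show (1 : ℝ) = Real.sqrt 1 from Real.sqrt_one.symm]
    exact Real.sqrt_lt_sqrt zero_le_one (by linarith)
  have hs0 : Real.sqrt p ≠ 0 := by positivity
  have hs1' : Real.sqrt p - 1 ≠ 0 := by linarith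
  have hr0 : 0 ≤ (Real.sqrt p)⁻¹ := by positivity
  have hr1 : (Real.sqrt p)⁻¹ < 1 := inv_lt_one_of_one_lt₀ hs1
  have hterm : ∀ j, j ≠ 0 → |hfun k (p ^ j)| * Real.sqrt (((p ^ j : ℕ) : ℝ)) =
      ((p : ℝ) - 1)⁻¹ * ((Real.sqrt p)⁻¹) ^ j := by
    intro j hj
    rw [abs_hfun_prime_pow_of_not_dvd k hp hpk hj, sqrt_natCast_pow, mul_assoc, ← mul_pow]
    congr 2
    rw [show ((p : ℝ))⁻¹ = (Real.sqrt p)⁻¹ * (Real.sqrt p)⁻¹ by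
      rw [← mul_inv, Real.mul_self_sqrt (Nat.cast_nonneg p)]]
    field_simp
  rw [Finset.range_eq_Ico, Finset.sum_eq_sum_Ico_succ_bot (Nat.succ_pos N), pow_zero,
    (isMultiplicative_hfun k).map_one, abs_one, Nat.cast_one, Real.sqrt_one, one_mul, zero_add]
  apply add_le_add le_rfl
  rw [Finset.sum_congr rfl fun j hj =>
    hterm j (by have := (Finset.mem_Ico.1 hj).1; omega), ← Finset.mul_sum]
  calc ((p : ℝ) - 1)⁻¹ * ∑ j ∈ Ico 1 (N + 1), ((Real.sqrt p)⁻¹) ^ j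
      ≤ ((p : ℝ) - 1)⁻¹ * (((Real.sqrt p)⁻¹) ^ 1 / (1 - (Real.sqrt p)⁻¹)) :=
        mul_le_mul_of_nonneg_left (geom_sum_Ico_le_of_lt_one hr0 hr1) (by positivity)
    _ = 1 / (((p : ℝ) - 1) * (Real.sqrt p - 1)) := by
        field_simp



/-! ### The products `Φ(k) = k/φ(k)` and `Z(k) = ∏_{p ∣ k}(1 - p^{-1/2})⁻¹`; global moment bounds -/

/-- `Φ(k) = ∏_{p ∣ k} (1 - 1/p)⁻¹ = k/φ(k) = 𝔖₁(k)` (GY (2.8)). [cite: GoldstonYildirim2001, (2.8)] -/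
def Phi : ℝ := ∏ p ∈ k.primeFactors, (1 - (p : ℝ)⁻¹)⁻¹

/-- `Z(k) = ∏_{p ∣ k} (1 - p^{-1/2})⁻¹`, the bound for GY's `|g_k(s)|` on `σ = -1/2` (cf. (3.5)).
[cite: GoldstonYildirim2001, (3.5)] -/
def Zk : ℝ := ∏ p ∈ k.primeFactors, (1 - (p : ℝ) ^ (-(1 / 2 : ℝ)))⁻¹

/-- The factors of `Φ(k)` are `≥ 1`. [folklore] -/
theorem one_le_inv_one_sub_inv {p : ℕ} (hp : p.Prime) : 1 ≤ (1 - (p : ℝ)⁻¹)⁻¹ := by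
  have hp2 : (2 : ℝ) ≤ p := by exact_mod_cast hp.two_le
  have hr0 : 0 ≤ (p : ℝ)⁻¹ := by positivity
  have hr1 : (p : ℝ)⁻¹ < 1 := inv_lt_one_of_one_lt₀ (by linarith)
  rw [le_inv_comm₀ one_pos (by linarith), inv_one]
  linarith

/-- The factors of `Z(k)` are `≥ 1`. [folklore] -/
theorem one_le_inv_one_sub_rpow {p : ℕ} (hp : p.Prime) : 1 ≤ (1 - (p : ℝ) ^ (-(1 / 2 : ℝ)))⁻¹ := by
  have hp2 : (2 : ℝ) ≤ p := by exact_mod_cast hp.two_le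
  have hs1 : 1 < Real.sqrt p := by
    rw [show (1 : ℝ) = Real.sqrt 1 from Real.sqrt_one.symm]
    exact Real.sqrt_lt_sqrt zero_le_one (by linarith)
  rw [Real.rpow_neg (Nat.cast_nonneg p), ← Real.sqrt_eq_rpow]
  have hr0 : 0 ≤ (Real.sqrt p)⁻¹ := by positivity
  have hr1 : (Real.sqrt p)⁻¹ < 1 := inv_lt_one_of_one_lt₀ hs1
  rw [le_inv_comm₀ one_pos (by linarith), inv_one]
  linarith

/-- `1 ≤ Φ(k)`. [folklore] -/
theorem one_le_Phi : 1 ≤ Phi k :=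
  GreenTao2008.SharpGY.one_le_prod_real fun _ hp =>
    one_le_inv_one_sub_inv (Nat.prime_of_mem_primeFactors hp)

/-- `1 ≤ Z(k)`. [folklore] -/
theorem one_le_Zk : 1 ≤ Zk k :=
  GreenTao2008.SharpGY.one_le_prod_real fun _ hp =>
    one_le_inv_one_sub_rpow (Nat.prime_of_mem_primeFactors hp)

/-- `x^{-3/2} = 1/(x √x)` for `x > 0`. [folklore] -/
theorem rpow_neg_three_halves {x : ℝ} (hx : 0 < x) : x ^ (-(3 : ℝ) / 2) = 1 / (x * Real.sqrt x) := by
  rw [show (-(3 : ℝ) / 2) = -((1 : ℝ) + 1 / 2) by norm_num, Real.rpow_neg hx.le, Real.rpow_add hx,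
    Real.rpow_one, Real.sqrt_eq_rpow, inv_eq_one_div]

/-- `1/(p-1)² ≤ 4/(p √p)` for `p ≥ 2`. [folklore] -/
theorem one_div_sub_one_sq_le {x : ℝ} (hx : 2 ≤ x) :
    1 / (x - 1) ^ 2 ≤ 4 * (1 / (x * Real.sqrt x)) := by
  have hx0 : 0 < x := by linarith
  have hs : Real.sqrt x ≤ x := by
    rw [Real.sqrt_le_left hx0.le]
    nlinarith
  have hs0 : 0 < Real.sqrt x := Real.sqrt_pos.2 hx0
  calc 1 / (x - 1) ^ 2 ≤ 1 / ((x / 2) ^ 2) := by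
        apply one_div_le_one_div_of_le (by positivity)
        apply pow_le_pow_left₀ (by positivity)
        linarith
    _ = 4 * (1 / (x * x)) := by
        field_simp
        ring
    _ ≤ 4 * (1 / (x * Real.sqrt x)) := by
        refine mul_le_mul_of_nonneg_left ?_ (by norm_num)
        apply one_div_le_one_div_of_le (by positivity)
        exact mul_le_mul_of_nonneg_left hs hx0.le

/-- `1/((p-1)(√p-1)) ≤ 8/(p √p)` for `p ≥ 2`. [folklore] -/
theorem one_div_sub_one_mul_le {x : ℝ} (hx : 2 ≤ x) :
    1 / ((x - 1) * (Real.sqrt x - 1)) ≤ 8 * (1 / (x * Real.sqrt x)) := by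
  have hx0 : 0 < x := by linarith
  have hs : 4 / 3 ≤ Real.sqrt x := by
    rw [show (4 : ℝ) / 3 = Real.sqrt ((4 / 3) ^ 2) by rw [Real.sqrt_sq]; norm_num]
    exact Real.sqrt_le_sqrt (by nlinarith)
  have hs0 : 0 < Real.sqrt x := by linarith
  calc 1 / ((x - 1) * (Real.sqrt x - 1)) ≤ 1 / ((x / 2) * (Real.sqrt x / 4)) := by
        apply one_div_le_one_div_of_le (by positivity)
        exact mul_le_mul (by linarith) (by linarith) (by positivity) (by linarith)
    _ = 8 * (1 / (x * Real.sqrt x)) := by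
        field_simp
        ring

/-- **`∑_{m ≤ N} |h_k(m)| ≤ e⁸ Φ(k)`** (Euler product bound for the nonnegative multiplicative
`|h_k|`: local factors `(1 - 1/p)⁻¹` at `p ∣ k` and `1 + 1/(p-1)² ≤ 1 + 4 p^{-3/2}` at `p ∤ k`,
`∑_p p^{-3/2} ≤ 2`). [folklore] -/
theorem sum_abs_hfun_le (hk : k ≠ 0) (N : ℕ) :
    ∑ m ∈ Icc 1 N, |hfun k m| ≤ Real.exp 8 * Phi k := by
  have step1 := SquarefreeSums.sum_le_prod_sum_prime_pow (isMultiplicative_habs k)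
    (fun n => abs_nonneg _) N
  simp only [habs_apply] at step1
  refine step1.trans ?_
  set u : ℕ → ℝ := fun p => if p ∣ k then (1 - (p : ℝ)⁻¹)⁻¹ else 1 with hu
  set v : ℕ → ℝ := fun p => 1 + 4 * (p : ℝ) ^ (-(3 : ℝ) / 2) with hv
  have hloc : ∀ p ∈ Nat.primesBelow (N + 1),
      ∑ j ∈ Finset.range (N + 1), |hfun k (p ^ j)| ≤ u p * v p := by
    intro p hp
    have hpp := (Nat.mem_primesBelow.1 hp).2
    have hp2 : (2 : ℝ) ≤ p := by exact_mod_cast hpp.two_le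
    have hp0 : (0 : ℝ) < p := by linarith
    have hv1 : 1 ≤ v p := by
      simp only [hv]
      have : 0 ≤ 4 * (p : ℝ) ^ (-(3 : ℝ) / 2) := by positivity
      linarith
    by_cases hpk : p ∣ k
    · simp only [hu, if_pos hpk]
      calc ∑ j ∈ Finset.range (N + 1), |hfun k (p ^ j)| ≤ (1 - (p : ℝ)⁻¹)⁻¹ :=
            sum_abs_hfun_prime_pow_le_of_dvd k hpp hpk N
        _ = (1 - (p : ℝ)⁻¹)⁻¹ * 1 := (mul_one _).symm
        _ ≤ (1 - (p : ℝ)⁻¹)⁻¹ * v p :=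
            mul_le_mul_of_nonneg_left hv1 (zero_le_one.trans (one_le_inv_one_sub_inv hpp))
    · simp only [hu, hv, if_neg hpk, one_mul]
      refine (sum_abs_hfun_prime_pow_le_of_not_dvd k hpp hpk N).trans ?_
      apply add_le_add le_rfl
      rw [rpow_neg_three_halves hp0]
      exact one_div_sub_one_sq_le hp2
  have hU : ∏ p ∈ Nat.primesBelow (N + 1), u p ≤ Phi k := by
    simp only [hu]
    rw [← Finset.prod_filter]
    unfold Phi
    apply GreenTao2008.SharpGY.prod_le_prod_of_subset_of_one_le_real
    · intro p hp
      rw [Finset.mem_filter, Nat.mem_primesBelow] at hp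
      exact Nat.mem_primeFactors.2 ⟨hp.1.2, hp.2, hk⟩
    · exact fun p hp => one_le_inv_one_sub_inv (Nat.prime_of_mem_primeFactors hp)
  have hV : ∏ p ∈ Nat.primesBelow (N + 1), v p ≤ Real.exp 8 := by
    simp only [hv]
    refine (SquarefreeSums.prod_one_add_le_exp_sum fun p _ => by positivity).trans ?_
    rw [Real.exp_le_exp, ← Finset.mul_sum]
    have := SquarefreeSums.sum_primesBelow_rpow_le N
    linarith
  calc ∏ p ∈ Nat.primesBelow (N + 1), ∑ j ∈ Finset.range (N + 1), |hfun k (p ^ j)|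
      ≤ ∏ p ∈ Nat.primesBelow (N + 1), (u p * v p) :=
        Finset.prod_le_prod (fun p _ => Finset.sum_nonneg fun _ _ => abs_nonneg _) hloc
    _ = (∏ p ∈ Nat.primesBelow (N + 1), u p) * ∏ p ∈ Nat.primesBelow (N + 1), v p :=
        Finset.prod_mul_distrib
    _ ≤ Phi k * Real.exp 8 :=
        mul_le_mul hU hV (Finset.prod_nonneg fun p _ => by simp only [hv]; positivity)
          (zero_le_one.trans (one_le_Phi k))
    _ = Real.exp 8 * Phi k := mul_comm _ _

/-- **`∑_{m ≤ N} |h_k(m)| √m ≤ e¹⁶ Z(k)`** (GY (3.5): the Euler product of `|h_k(m)| m^{1/2}` has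
local factors `(1 - p^{-1/2})⁻¹` at `p ∣ k` and `1 + 1/((p-1)(√p-1)) ≤ 1 + 8 p^{-3/2}` at
`p ∤ k`). [cite: GoldstonYildirim2001, (3.5)] -/
theorem sum_absSqrt_hfun_le (hk : k ≠ 0) (N : ℕ) :
    ∑ m ∈ Icc 1 N, |hfun k m| * Real.sqrt m ≤ Real.exp 16 * Zk k := by
  have step1 := SquarefreeSums.sum_le_prod_sum_prime_pow (isMultiplicative_habsSqrt k)
    (fun n => by rw [habsSqrt_apply]; positivity) N
  simp only [habsSqrt_apply] at step1
  refine step1.trans ?_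
  set u : ℕ → ℝ := fun p => if p ∣ k then (1 - (p : ℝ) ^ (-(1 / 2 : ℝ)))⁻¹ else 1 with hu
  set v : ℕ → ℝ := fun p => 1 + 8 * (p : ℝ) ^ (-(3 : ℝ) / 2) with hv
  have hloc : ∀ p ∈ Nat.primesBelow (N + 1),
      ∑ j ∈ Finset.range (N + 1), |hfun k (p ^ j)| * Real.sqrt (((p ^ j : ℕ) : ℝ)) ≤ u p * v p := by
    intro p hp
    have hpp := (Nat.mem_primesBelow.1 hp).2
    have hp2 : (2 : ℝ) ≤ p := by exact_mod_cast hpp.two_le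
    have hp0 : (0 : ℝ) < p := by linarith
    have hv1 : 1 ≤ v p := by
      simp only [hv]
      have : 0 ≤ 8 * (p : ℝ) ^ (-(3 : ℝ) / 2) := by positivity
      linarith
    by_cases hpk : p ∣ k
    · simp only [hu, if_pos hpk]
      calc ∑ j ∈ Finset.range (N + 1), |hfun k (p ^ j)| * Real.sqrt (((p ^ j : ℕ) : ℝ))
          ≤ (1 - (p : ℝ) ^ (-(1 / 2 : ℝ)))⁻¹ := sum_absSqrt_hfun_prime_pow_le_of_dvd k hpp hpk N
        _ = (1 - (p : ℝ) ^ (-(1 / 2 : ℝ)))⁻¹ * 1 := (mul_one _).symm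
        _ ≤ (1 - (p : ℝ) ^ (-(1 / 2 : ℝ)))⁻¹ * v p :=
            mul_le_mul_of_nonneg_left hv1 (zero_le_one.trans (one_le_inv_one_sub_rpow hpp))
    · simp only [hu, hv, if_neg hpk, one_mul]
      refine (sum_absSqrt_hfun_prime_pow_le_of_not_dvd k hpp hpk N).trans ?_
      apply add_le_add le_rfl
      rw [rpow_neg_three_halves hp0]
      exact one_div_sub_one_mul_le hp2
  have hU : ∏ p ∈ Nat.primesBelow (N + 1), u p ≤ Zk k := by
    simp only [hu]
    rw [← Finset.prod_filter]
    unfold Zk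
    apply GreenTao2008.SharpGY.prod_le_prod_of_subset_of_one_le_real
    · intro p hp
      rw [Finset.mem_filter, Nat.mem_primesBelow] at hp
      exact Nat.mem_primeFactors.2 ⟨hp.1.2, hp.2, hk⟩
    · exact fun p hp => one_le_inv_one_sub_rpow (Nat.prime_of_mem_primeFactors hp)
  have hV : ∏ p ∈ Nat.primesBelow (N + 1), v p ≤ Real.exp 16 := by
    simp only [hv]
    refine (SquarefreeSums.prod_one_add_le_exp_sum fun p _ => by positivity).trans ?_
    rw [Real.exp_le_exp, ← Finset.mul_sum]
    have := SquarefreeSums.sum_primesBelow_rpow_le N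
    linarith
  calc ∏ p ∈ Nat.primesBelow (N + 1), ∑ j ∈ Finset.range (N + 1),
        |hfun k (p ^ j)| * Real.sqrt (((p ^ j : ℕ) : ℝ))
      ≤ ∏ p ∈ Nat.primesBelow (N + 1), (u p * v p) :=
        Finset.prod_le_prod (fun p _ => Finset.sum_nonneg fun _ _ => by positivity) hloc
    _ = (∏ p ∈ Nat.primesBelow (N + 1), u p) * ∏ p ∈ Nat.primesBelow (N + 1), v p :=
        Finset.prod_mul_distrib
    _ ≤ Zk k * Real.exp 16 :=
        mul_le_mul hU hV (Finset.prod_nonneg fun p _ => by simp only [hv]; positivity)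
          (zero_le_one.trans (one_le_Zk k))
    _ = Real.exp 16 * Zk k := mul_comm _ _

/-! ### The Euler product: `∑_m h_k(m) = 𝔖({0, k})` (GY p. 16, residue at `s = 0`) -/

/-- `∑_{i < n+1} f(i) = ∑_{1 ≤ i ≤ n} f(i)` when `f(0) = 0`. [folklore] -/
theorem sum_range_succ_eq_sum_Icc (f : ℕ → ℝ) (hf : f 0 = 0) (n : ℕ) :
    ∑ i ∈ Finset.range (n + 1), f i = ∑ i ∈ Icc 1 n, f i := by
  rw [Finset.range_eq_Ico, Finset.sum_eq_sum_Ico_succ_bot (by omega : 0 < n + 1), hf, zero_add,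
    zero_add, Finset.Ico_add_one_right_eq_Icc]

/-- `∑_n |h_k(n)| < ∞`. [folklore] -/
theorem summable_norm_hfun (hk : k ≠ 0) : Summable (fun n => ‖hfun k n‖) := by
  refine summable_of_sum_range_le (c := Real.exp 8 * Phi k) (fun n => norm_nonneg _) fun n => ?_
  rcases n with _ | n
  · rw [Finset.sum_range_zero]
    have := one_le_Phi k
    positivity
  · calc ∑ i ∈ Finset.range (n + 1), ‖hfun k i‖ = ∑ i ∈ Icc 1 n, |hfun k i| := by
          rw [sum_range_succ_eq_sum_Icc (fun i => ‖hfun k i‖) (by simp) n]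
          simp only [Real.norm_eq_abs]
      _ ≤ Real.exp 8 * Phi k := sum_abs_hfun_le k hk n

/-- `∑_e h_k(p^e) = (1 - 1/p)⁻¹` for `p ∣ k`. [folklore] -/
theorem tsum_hfun_prime_pow_of_dvd {p : ℕ} (hp : p.Prime) (hpk : p ∣ k) :
    ∑' e, hfun k (p ^ e) = (1 - (p : ℝ)⁻¹)⁻¹ := by
  simp_rw [hfun_apply_prime_pow k hp, hloc_of_dvd k hpk]
  exact tsum_geometric_of_lt_one (by positivity)
    (inv_lt_one_of_one_lt₀ (by exact_mod_cast hp.one_lt))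

/-- `∑_e h_k(p^e) = 1 + 1/(p-1) - (1/(p-1))(1 - 1/p)⁻¹ (= 1 - 1/(p-1)²)` for `p ∤ k`. [folklore] -/
theorem hasSum_hfun_prime_pow_of_not_dvd {p : ℕ} (hp : p.Prime) (hpk : ¬p ∣ k) :
    HasSum (fun e => hfun k (p ^ e))
      (1 + ((p : ℝ) - 1)⁻¹ + -((p : ℝ) - 1)⁻¹ * (1 - (p : ℝ)⁻¹)⁻¹) := by
  have hp2 : (2 : ℝ) ≤ p := by exact_mod_cast hp.two_le
  have hr0 : 0 ≤ (p : ℝ)⁻¹ := by positivity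
  have hr1 : (p : ℝ)⁻¹ < 1 := inv_lt_one_of_one_lt₀ (by linarith)
  have hfeq : (fun e => hfun k (p ^ e)) =
      fun e => (if e = 0 then 1 + ((p : ℝ) - 1)⁻¹ else 0) + -((p : ℝ) - 1)⁻¹ * ((p : ℝ)⁻¹) ^ e := by
    funext e
    rw [hfun_apply_prime_pow k hp]
    rcases Nat.eq_zero_or_pos e with rfl | he
    · rw [hloc_zero, if_pos rfl, pow_zero]; ring
    · rw [hloc_of_not_dvd k hpk he.ne', if_neg he.ne', mul_inv, inv_pow]; ring
  rw [hfeq]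
  have h1 : HasSum (fun e : ℕ => if e = 0 then 1 + ((p : ℝ) - 1)⁻¹ else 0) (1 + ((p : ℝ) - 1)⁻¹) :=
    hasSum_ite_eq 0 _
  exact h1.add ((hasSum_geometric_of_lt_one hr0 hr1).mul_left (-((p : ℝ) - 1)⁻¹))

/-- `ν_{{0,k}}(p) = 1` if `p ∣ k` and `= 2` otherwise (`p` prime, `k ≥ 1`). [folklore] -/
theorem tupleResidueCount_zero_pair (p : ℕ) :
    tupleResidueCount ({0, (k : ℤ)} : Finset ℤ) p = if p ∣ k then 1 else 2 := by
  unfold tupleResidueCount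
  rw [Finset.image_insert, Finset.image_singleton, Int.cast_zero, Int.cast_natCast]
  by_cases hpk : p ∣ k
  · rw [if_pos hpk, (ZMod.natCast_eq_zero_iff k p).2 hpk, Finset.insert_eq_of_mem
      (Finset.mem_singleton_self _), Finset.card_singleton]
  · have hne : (0 : ZMod p) ≠ (k : ZMod p) := fun h => hpk ((ZMod.natCast_eq_zero_iff k p).1 h.symm)
    rw [if_neg hpk, Finset.card_pair hne]

/-- The Euler factor of `𝔖({0,k})` at `p`: `(1 - 1/p)⁻¹` if `p ∣ k`, `1 - 1/(p-1)²` otherwise.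
[cite: GoldstonYildirim2001, (2.5)–(2.9)] -/
theorem singularSeriesFactor_zero_pair (hk : k ≠ 0) {p : ℕ} (hp : p.Prime) :
    singularSeriesFactor ({0, (k : ℤ)} : Finset ℤ) p =
      if p ∣ k then (1 - (p : ℝ)⁻¹)⁻¹
      else 1 + ((p : ℝ) - 1)⁻¹ + -((p : ℝ) - 1)⁻¹ * (1 - (p : ℝ)⁻¹)⁻¹ := by
  have hp2 : (2 : ℝ) ≤ p := by exact_mod_cast hp.two_le
  have hp0 : (p : ℝ) ≠ 0 := by positivity
  have hp1 : (p : ℝ) - 1 ≠ 0 := by linarith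
  have hcard : ({0, (k : ℤ)} : Finset ℤ).card = 2 :=
    Finset.card_pair (by exact_mod_cast hk.symm : (0 : ℤ) ≠ k)
  rw [singularSeriesFactor, hcard, tupleResidueCount_zero_pair k p]
  have e1 : (1 : ℝ) - 1 / p = ((p : ℝ) - 1) / p := by field_simp
  split_ifs with hpk
  · push_cast
    rw [inv_eq_one_div (p : ℝ), e1, inv_div]
    field_simp
  · push_cast
    rw [inv_eq_one_div (p : ℝ), e1, inv_div]
    field_simp
    ring

/-- **`𝔖({0,k}) = ∑_m h_k(m)`** (the residue `g_k(0) h_k(0) = 𝔖₂(k)` of GY p. 16, as an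
absolutely convergent Euler product). [cite: GoldstonYildirim2001, (3.4)] -/
theorem singularSeries_zero_pair_eq_tsum (hk : k ≠ 0) :
    singularSeries ({0, (k : ℤ)} : Finset ℤ) = ∑' n, hfun k n := by
  rw [← (isMultiplicative_hfun k).eulerProduct_tprod (summable_norm_hfun k hk),
    ← (hasProd_singularSeriesFactor_holds _).tprod_eq]
  refine tprod_congr fun p => ?_
  rw [singularSeriesFactor_zero_pair k hk p.2]
  split_ifs with hpk
  · exact (tsum_hfun_prime_pow_of_dvd k p.2 hpk).symm
  · exact ((hasSum_hfun_prime_pow_of_not_dvd k p.2 hpk).tsum_eq).symm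

/-- **Tail of the series**: if `∑_{m ≤ M} |h_k(m)| √m ≤ W` for all `M`, then
`|∑_m h_k(m) - ∑_{m ≤ X} h_k(m)| ≤ W/√(X+1)`. [folklore] -/
theorem abs_tsum_sub_sum_le (hk : k ≠ 0) (X : ℕ) {W : ℝ}
    (hW : ∀ M, ∑ m ∈ Icc 1 M, |hfun k m| * Real.sqrt m ≤ W) :
    |∑' n, hfun k n - ∑ m ∈ Icc 1 X, hfun k m| ≤ W / Real.sqrt ((X : ℝ) + 1) := by
  have hs := (summable_norm_hfun k hk).of_norm
  have hX0 : 0 < Real.sqrt ((X : ℝ) + 1) := Real.sqrt_pos.2 (by positivity)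
  have htend : Tendsto (fun M : ℕ => ∑ m ∈ Icc 1 M, hfun k m) atTop (𝓝 (∑' n, hfun k n)) := by
    have h := hs.hasSum.tendsto_sum_nat.comp (tendsto_add_atTop_nat 1)
    refine h.congr fun M => ?_
    exact sum_range_succ_eq_sum_Icc (fun i => hfun k i) (by simp) M
  have hbound : ∀ M, X ≤ M →
      |∑ m ∈ Icc 1 M, hfun k m - ∑ m ∈ Icc 1 X, hfun k m| ≤ W / Real.sqrt ((X : ℝ) + 1) := by
    intro M hXM
    have hsplit : ∑ m ∈ Icc 1 M, hfun k m - ∑ m ∈ Icc 1 X, hfun k m =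
        ∑ m ∈ (Icc 1 M).filter (fun m => ¬m ≤ X), hfun k m := by
      rw [← Finset.sum_filter_add_sum_filter_not (Icc 1 M) (fun m => m ≤ X)]
      have : (Icc 1 M).filter (fun m => m ≤ X) = Icc 1 X := by
        ext m
        simp only [Finset.mem_filter, Finset.mem_Icc]
        omega
      rw [this]
      ring
    rw [hsplit]
    set T := (Icc 1 M).filter (fun m => ¬m ≤ X) with hT
    calc |∑ m ∈ T, hfun k m| ≤ ∑ m ∈ T, |hfun k m| := Finset.abs_sum_le_sum_abs _ _
      _ ≤ ∑ m ∈ T, |hfun k m| * Real.sqrt m / Real.sqrt ((X : ℝ) + 1) := by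
          refine Finset.sum_le_sum fun m hm => ?_
          rw [hT, Finset.mem_filter, not_le] at hm
          rw [le_div_iff₀ hX0]
          refine mul_le_mul_of_nonneg_left (Real.sqrt_le_sqrt ?_) (abs_nonneg _)
          exact_mod_cast hm.2
      _ = (∑ m ∈ T, |hfun k m| * Real.sqrt m) / Real.sqrt ((X : ℝ) + 1) := by
          rw [Finset.sum_div]
      _ ≤ (∑ m ∈ Icc 1 M, |hfun k m| * Real.sqrt m) / Real.sqrt ((X : ℝ) + 1) := by
          refine div_le_div_of_nonneg_right ?_ hX0.le
          exact Finset.sum_le_sum_of_subset_of_nonneg (Finset.filter_subset _ _)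
            fun _ _ _ => by positivity
      _ ≤ W / Real.sqrt ((X : ℝ) + 1) := div_le_div_of_nonneg_right (hW M) hX0.le
  exact le_of_tendsto ((htend.sub_const _).abs) (eventually_atTop.2 ⟨X, hbound⟩)



end GoldstonYildirimLemma21

/-! ### Assembly: Lemma 2.1, (2.11)–(2.12) at `j = 1` -/

open GoldstonYildirimLemma21 in
/-- **Goldston–Yıldırım I, Lemma 2.1, (2.11)–(2.12) at `j = 1`** (discharge of
`goldstonYildirim_lemma21_log_j1`): there is an absolute `c > 0` such that for every `B > 0` there
is `C` with `|∑_{d ≤ R, (d,k)=1} μ(d)/φ(d) · log(R/d) - 𝔖({0,k})| ≤ C exp(-c√log R)` for all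
`k ≥ 1`, `R ≥ 1`, `k ≤ R^B`.

Proof (GY §3 with the contour integral replaced by the tree's real-variable input). By (3.1),
`μ 𝟙_{(·,k)=1}/φ = h_k ⋆ μ/id`, so the sum is `∑_{m ≤ R} h_k(m) M₁(R/m)` with
`M₁(u) = ∑_{e ≤ u} μ(e) log(u/e)/e = 1 + O(e^{-c₁√log u})`; the main term is
`∑_m h_k(m) = 𝔖₂(k) = 𝔖({0,k})` (the residue computation of p. 16), the tail `∑_{m > R} |h_k(m)|`
and the terms `√R < m ≤ R` are `≪ R^{-1/4} ∑_m |h_k(m)| √m ≪ R^{-1/4} e^{8√(ω(k)+1)}` (the bound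
(3.5) `|g_k| ≪ e^{4√log k}`), and the terms `m ≤ √R` contribute `≪ (k/φ(k)) e^{-(c₁/2)√log R}` with
`k/φ(k) ≤ ω(k) + 1 ≤ 2B log R + 1`; `c = c₁/4`. [cite: GoldstonYildirim2001, Lemma 2.1 (2.11) with j = 1] -/
theorem goldstonYildirim_lemma21_log_j1_holds : goldstonYildirim_lemma21_log_j1 := by
  obtain ⟨c₁, hc₁, C₁, hC₁, hM₁⟩ := exists_abs_moebiusLogSum_sub_one_le_of_one_le
  refine ⟨c₁ / 4, by positivity, fun B hB => ?_⟩
  set T : ℝ := 2 / (c₁ / 4) ^ 2 with hT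
  set κ : ℝ := 8 * Real.sqrt (2 * B) + c₁ / 4 with hκ
  refine ⟨C₁ * Real.exp 8 * (1 + 2 * B * T) + (C₁ + 1) * Real.exp 24 * Real.exp (κ ^ 2),
    fun k hk R hR hkR => ?_⟩
  have hk0 : k ≠ 0 := by omega
  have hR0 : 0 < R := by linarith
  -- notation: `L = log R = u²`
  set L : ℝ := Real.log R with hL
  set u : ℝ := Real.sqrt L with hu
  have hL0 : 0 ≤ L := Real.log_nonneg hR
  have hu0 : 0 ≤ u := Real.sqrt_nonneg _
  have huL : u ^ 2 = L := Real.sq_sqrt hL0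
  set X : ℕ := ⌊R⌋₊ with hX
  -- `ω(k) ≤ 2 B u²` (this is where `log k ≪ log R` enters)
  have hωL : (k.primeFactors.card : ℝ) ≤ 2 * B * u ^ 2 := by
    rw [huL]
    exact card_primeFactors_le_of_le_rpow hk0 hR0 hkR
  have hsqrtω : Real.sqrt (k.primeFactors.card + 1) ≤ Real.sqrt (2 * B) * u + 1 := by
    rw [Real.sqrt_le_left (by positivity)]
    have h2B : Real.sqrt (2 * B) ^ 2 = 2 * B := Real.sq_sqrt (by linarith)
    nlinarith [Real.sqrt_nonneg (2 * B)]
  -- the two moment bounds, uniform in the length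
  have hH : ∀ N, ∑ m ∈ Icc 1 N, |hfun k m| ≤ Real.exp 8 * (1 + 2 * B * u ^ 2) := fun N =>
    (sum_abs_hfun_le k hk0 N).trans (mul_le_mul_of_nonneg_left
      ((prod_inv_one_sub_inv_le_card _ fun _ hp => Nat.prime_of_mem_primeFactors hp).trans
        (by linarith)) (Real.exp_pos _).le)
  have hW : ∀ N, ∑ m ∈ Icc 1 N, |hfun k m| * Real.sqrt m ≤
      Real.exp 24 * Real.exp (8 * (Real.sqrt (2 * B) * u)) := by
    intro N
    refine (sum_absSqrt_hfun_le k hk0 N).trans ?_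
    have hZ := prod_inv_one_sub_rpow_le_exp k.primeFactors fun _ hp => Nat.prime_of_mem_primeFactors hp
    calc Real.exp 16 * Zk k ≤ Real.exp 16 * Real.exp (8 * (Real.sqrt (2 * B) * u + 1)) :=
          mul_le_mul_of_nonneg_left (hZ.trans (Real.exp_le_exp.2 (by nlinarith)))
            (Real.exp_pos _).le
      _ = Real.exp 24 * Real.exp (8 * (Real.sqrt (2 * B) * u)) := by
          rw [← Real.exp_add, ← Real.exp_add]
          congr 1
          ring
  -- Step 1: the identity `S(R) = ∑_{m ≤ R} h_k(m) M₁(R/m)` and `𝔖 = ∑ h_k`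
  rw [sum_filter_coprime_eq, sum_gfun_mul_log_eq, singularSeries_zero_pair_eq_tsum k hk0]
  have hdecomp : ∑ m ∈ Icc 1 X, hfun k m * GreenTao2008.moebiusLogSum (R / m) - ∑' n, hfun k n =
      ∑ m ∈ Icc 1 X, hfun k m * (GreenTao2008.moebiusLogSum (R / m) - 1) -
        (∑' n, hfun k n - ∑ m ∈ Icc 1 X, hfun k m) := by
    have : ∑ m ∈ Icc 1 X, hfun k m * (GreenTao2008.moebiusLogSum (R / m) - 1) =
        ∑ m ∈ Icc 1 X, hfun k m * GreenTao2008.moebiusLogSum (R / m) - ∑ m ∈ Icc 1 X, hfun k m := by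
      rw [← Finset.sum_sub_distrib]
      exact Finset.sum_congr rfl fun m _ => by ring
    rw [this]
    ring
  -- Step 2: `E₁ = ∑ h_k(m) (M₁(R/m) - 1)`
  have hE1 : |∑ m ∈ Icc 1 X, hfun k m * (GreenTao2008.moebiusLogSum (R / m) - 1)| ≤
      C₁ * Real.exp (-(c₁ / 2 * u)) * (Real.exp 8 * (1 + 2 * B * u ^ 2)) +
      C₁ * Real.exp (-(L / 4)) * (Real.exp 24 * Real.exp (8 * (Real.sqrt (2 * B) * u))) := by
    refine (Finset.abs_sum_le_sum_abs _ _).trans ?_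
    have hpt : ∀ m ∈ Icc 1 X, |hfun k m * (GreenTao2008.moebiusLogSum (R / m) - 1)| ≤
        C₁ * Real.exp (-(c₁ / 2 * u)) * |hfun k m| +
          C₁ * Real.exp (-(L / 4)) * (|hfun k m| * Real.sqrt m) := by
      intro m hm
      obtain ⟨hm1, hmX⟩ := Finset.mem_Icc.1 hm
      have hm0 : (0 : ℝ) < m := by exact_mod_cast hm1
      have hmR : (m : ℝ) ≤ R := le_trans (by exact_mod_cast hmX) (Nat.floor_le hR0.le)
      have hRm : 1 ≤ R / m := by rwa [le_div_iff₀ hm0, one_mul]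
      rw [abs_mul]
      have hMb := hM₁ (R / m) hRm
      rcases le_or_gt ((m : ℝ) ^ 2) R with hcase | hcase
      · -- `m ≤ √R`: `log(R/m) ≥ L/2 ≥ (u/2)²`
        have hlogm : 2 * Real.log m ≤ L := by
          have e : Real.log ((m : ℝ) ^ 2) = 2 * Real.log m := by
            rw [Real.log_pow]; norm_num
          rw [← e]
          exact Real.log_le_log (by positivity) hcase
        have hlogRm : (u / 2) ^ 2 ≤ Real.log (R / m) := by
          rw [Real.log_div hR0.ne' hm0.ne', div_pow, huL]
          linarith
        have hsq : u / 2 ≤ Real.sqrt (Real.log (R / m)) := by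
          have := Real.sqrt_le_sqrt hlogRm
          rwa [Real.sqrt_sq (by positivity)] at this
        have e1 : |GreenTao2008.moebiusLogSum (R / m) - 1| ≤ C₁ * Real.exp (-(c₁ / 2 * u)) :=
          hMb.trans (mul_le_mul_of_nonneg_left (Real.exp_le_exp.2 (by nlinarith)) hC₁)
        calc |hfun k m| * |GreenTao2008.moebiusLogSum (R / m) - 1|
            ≤ |hfun k m| * (C₁ * Real.exp (-(c₁ / 2 * u))) :=
              mul_le_mul_of_nonneg_left e1 (abs_nonneg _)
          _ = C₁ * Real.exp (-(c₁ / 2 * u)) * |hfun k m| := by ring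
          _ ≤ C₁ * Real.exp (-(c₁ / 2 * u)) * |hfun k m| +
                C₁ * Real.exp (-(L / 4)) * (|hfun k m| * Real.sqrt m) :=
              le_add_of_nonneg_right (by positivity)
      · -- `m > √R`: `1 ≤ √m e^{-L/4}`
        have hlogm : L < 2 * Real.log m := by
          have e : Real.log ((m : ℝ) ^ 2) = 2 * Real.log m := by
            rw [Real.log_pow]; norm_num
          rw [← e]
          exact Real.log_lt_log hR0 hcase
        have hkey : 1 ≤ Real.sqrt m * Real.exp (-(L / 4)) := by
          have h1 : Real.exp (L / 4) ≤ Real.sqrt m := by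
            rw [Real.sqrt_eq_rpow, Real.rpow_def_of_pos hm0]
            exact Real.exp_le_exp.2 (by linarith)
          calc (1 : ℝ) = Real.exp (L / 4) * Real.exp (-(L / 4)) := by
                rw [← Real.exp_add, add_neg_cancel, Real.exp_zero]
            _ ≤ Real.sqrt m * Real.exp (-(L / 4)) :=
                mul_le_mul_of_nonneg_right h1 (Real.exp_pos _).le
        have e2 : |GreenTao2008.moebiusLogSum (R / m) - 1| ≤ C₁ := by
          refine hMb.trans ?_
          calc C₁ * Real.exp (-(c₁ * Real.sqrt (Real.log (R / m)))) ≤ C₁ * 1 :=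
                mul_le_mul_of_nonneg_left (Real.exp_le_one_iff.2 (neg_nonpos.2 (by positivity))) hC₁
            _ = C₁ := mul_one _
        calc |hfun k m| * |GreenTao2008.moebiusLogSum (R / m) - 1| ≤ |hfun k m| * C₁ :=
              mul_le_mul_of_nonneg_left e2 (abs_nonneg _)
          _ = C₁ * (|hfun k m| * 1) := by ring
          _ ≤ C₁ * (|hfun k m| * (Real.sqrt m * Real.exp (-(L / 4)))) :=
              mul_le_mul_of_nonneg_left (mul_le_mul_of_nonneg_left hkey (abs_nonneg _)) hC₁
          _ = C₁ * Real.exp (-(L / 4)) * (|hfun k m| * Real.sqrt m) := by ring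
          _ ≤ C₁ * Real.exp (-(c₁ / 2 * u)) * |hfun k m| +
                C₁ * Real.exp (-(L / 4)) * (|hfun k m| * Real.sqrt m) :=
              le_add_of_nonneg_left (by positivity)
    calc ∑ m ∈ Icc 1 X, |hfun k m * (GreenTao2008.moebiusLogSum (R / m) - 1)|
        ≤ ∑ m ∈ Icc 1 X, (C₁ * Real.exp (-(c₁ / 2 * u)) * |hfun k m| +
            C₁ * Real.exp (-(L / 4)) * (|hfun k m| * Real.sqrt m)) := Finset.sum_le_sum hpt
      _ = C₁ * Real.exp (-(c₁ / 2 * u)) * ∑ m ∈ Icc 1 X, |hfun k m| +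
            C₁ * Real.exp (-(L / 4)) * ∑ m ∈ Icc 1 X, |hfun k m| * Real.sqrt m := by
          rw [Finset.sum_add_distrib, ← Finset.mul_sum, ← Finset.mul_sum]
      _ ≤ _ := add_le_add (mul_le_mul_of_nonneg_left (hH X) (by positivity))
            (mul_le_mul_of_nonneg_left (hW X) (by positivity))
  -- Step 3: the tail `E₂ = ∑_m h_k(m) - ∑_{m ≤ R} h_k(m)`
  have hE2 : |∑' n, hfun k n - ∑ m ∈ Icc 1 X, hfun k m| ≤
      Real.exp (-(L / 4)) * (Real.exp 24 * Real.exp (8 * (Real.sqrt (2 * B) * u))) := by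
    refine (abs_tsum_sub_sum_le k hk0 X hW).trans ?_
    rw [div_eq_mul_inv, mul_comm]
    refine mul_le_mul_of_nonneg_right ?_ (by positivity)
    have hXR : R ≤ (X : ℝ) + 1 := (Nat.lt_floor_add_one R).le
    have h1 : Real.exp (L / 4) ≤ Real.sqrt ((X : ℝ) + 1) := by
      have hsqrtR : Real.sqrt R = Real.exp (L / 2) := by
        rw [Real.sqrt_eq_rpow, Real.rpow_def_of_pos hR0, hL]
        ring_nf
      calc Real.exp (L / 4) ≤ Real.exp (L / 2) := Real.exp_le_exp.2 (by linarith)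
        _ = Real.sqrt R := hsqrtR.symm
        _ ≤ Real.sqrt ((X : ℝ) + 1) := Real.sqrt_le_sqrt hXR
    rw [Real.exp_neg]
    exact inv_anti₀ (Real.exp_pos _) h1
  -- Step 4: bookkeeping of the exponentials
  set E : ℝ := Real.exp (-(c₁ / 4) * Real.sqrt (Real.log R)) with hE
  have hE' : E = Real.exp (-(c₁ / 4 * u)) := by rw [hE, hu, hL, neg_mul]
  have hE0 : 0 ≤ E := (Real.exp_pos _).le
  have hEle : E ≤ 1 := by
    rw [hE', Real.exp_le_one_iff, neg_nonpos]
    positivity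
  have hA : Real.exp (-(c₁ / 2 * u)) = E * E := by
    rw [hE', ← Real.exp_add]
    congr 1
    ring
  have huE : u ^ 2 * E ≤ T := by
    rw [hE', hT]
    exact sq_mul_exp_neg_mul_le (by positivity) hu0
  have hT1 : (1 + 2 * B * u ^ 2) * E ≤ 1 + 2 * B * T := by
    calc (1 + 2 * B * u ^ 2) * E = E + 2 * B * (u ^ 2 * E) := by ring
      _ ≤ 1 + 2 * B * T := add_le_add hEle (mul_le_mul_of_nonneg_left huE (by linarith))
  have hT2 : Real.exp (-(L / 4)) * Real.exp (8 * (Real.sqrt (2 * B) * u)) ≤ Real.exp (κ ^ 2) * E := by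
    rw [hE', ← Real.exp_add, ← Real.exp_add, Real.exp_le_exp, hκ]
    nlinarith [sq_nonneg (8 * Real.sqrt (2 * B) + c₁ / 4 - u / 2), huL]
  -- Step 5: conclusion
  rw [hdecomp]
  calc |∑ m ∈ Icc 1 X, hfun k m * (GreenTao2008.moebiusLogSum (R / m) - 1) -
          (∑' n, hfun k n - ∑ m ∈ Icc 1 X, hfun k m)|
      ≤ |∑ m ∈ Icc 1 X, hfun k m * (GreenTao2008.moebiusLogSum (R / m) - 1)| +
          |∑' n, hfun k n - ∑ m ∈ Icc 1 X, hfun k m| := abs_sub _ _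
    _ ≤ C₁ * Real.exp (-(c₁ / 2 * u)) * (Real.exp 8 * (1 + 2 * B * u ^ 2)) +
          C₁ * Real.exp (-(L / 4)) * (Real.exp 24 * Real.exp (8 * (Real.sqrt (2 * B) * u))) +
          Real.exp (-(L / 4)) * (Real.exp 24 * Real.exp (8 * (Real.sqrt (2 * B) * u))) :=
        add_le_add hE1 hE2
    _ = C₁ * Real.exp 8 * ((1 + 2 * B * u ^ 2) * E) * E +
          (C₁ + 1) * Real.exp 24 *
            (Real.exp (-(L / 4)) * Real.exp (8 * (Real.sqrt (2 * B) * u))) := by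
        rw [hA]; ring
    _ ≤ C₁ * Real.exp 8 * (1 + 2 * B * T) * E + (C₁ + 1) * Real.exp 24 * (Real.exp (κ ^ 2) * E) :=
        add_le_add (mul_le_mul_of_nonneg_right (mul_le_mul_of_nonneg_left hT1 (by positivity)) hE0)
          (mul_le_mul_of_nonneg_left hT2 (by positivity))
    _ = (C₁ * Real.exp 8 * (1 + 2 * B * T) + (C₁ + 1) * Real.exp 24 * Real.exp (κ ^ 2)) * E := by
        ring

end Literature.NumberTheory.Sieve
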